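import Summits.CriticalPhenomena.PercolationContinuityZ3.Theorems.PercNearOneGluingNoHeavyLowerTailReimerCertificate
import Summits.CriticalPhenomena.PercolationContinuityZ3.Theorems.PercNearOneGluingNoHeavyLowerTailReimerForcing
import Summits.CriticalPhenomena.PercolationContinuityZ3.Theorems.PercNearOneGluingNoHeavyLowerTailAntipodalR1NestedGraded
import HarnessLib

/-!
# ANTI₁ when the apex is adjacent to ONE terminal

Support file for `stmt-CriticalPhenomena-4575` (memo `prim-gen-kcluster/KCLUSTER-gen74.md` §4; conjecture
ANTI₁ of `KCLUSTER-gen52.md` §3).  No definitions, no named facts, no sorries.  Vocabulary of `AntipodalR1`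
(`clus`, `region`, `lSet`, `rSet`, `tSet`; gen 62) and the Reimer-certificate theorem
`AntipodalR1.card_lSet_le_of_certificate` with the forcing lemma `AntipodalR1.cylinder_subset_rSet` (gen 74).

**Theorem** (`AntipodalR1.card_lSet_le_card_rSet_of_adj_left`).  For every finite multigraph
`ends : ι → Sym2 V` and vertices `a, b, c` with `a ~ b`:
`#{x : b, c ∈ O_a ∖ K_a, K_a separates b | c} ≤ #{x : b ∈ O_a ∖ K_a, c ∈ K_a ∖ O_a}`, i.e. ANTI₁ (ungraded,
`q = 1`) holds whenever the apex is adjacent to the terminal `b`; by the `b ↔ c` symmetry of the left side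
and the flip symmetry of the right side also whenever `a ~ c` (`…_of_adj_right`).  This strictly contains
gen 62's `card_lSet_le_card_rSet_of_adj` (`a ~ b` AND `a ~ c`, one application of the flip lemma); here a
genuine multi-class Reimer certificate is needed (one class does not exist in general, memo §4).

**Certificate.**  For `x ∈ L` let `B(x) = K_b(x)` be the closed cluster of `b` and `E_B` the edges with an
end in `B(x)`.  Class of `x` := the pattern of `x` on `E_B` (formally `e ↦ some (x e)` on `E_B`, `none`
off it; equal patterns force equal `B`, `clusB_subset_of_key`); flip set `T(x) := O(x) ∖ E_B` (close every
open edge not touching `K_b`); all targets `R(b,c)`.  (F) for class-mates `x₁, x₂` the determined-open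
edges contain `O(x₁) ∩ E_B ∋ ab` (so `a ~ b`, F1) which is an `a–b` cut (the boundary of the closed
cluster `B` is open, F2); the determined-closed edges `K(x₁) ∪ T(x₂)` join `a` to `c` (F3: every vertex of
`O_a(x₂)` lies in `b`'s region of `x₁` or is so joined — a step leaving the region lands in `K_a(x₁)`, a step
off `E_B` is in `T(x₂)`, and `c` is not in `b`'s region of `x₁`) and cut `a` from `c` (F4: the vertices
reachable from `a` avoiding them stay inside `K_a(x₂) ∪` (b's region of `x₂`), which misses `c`).  (D) two
classes with the same `B` differ on an edge of `E_B`, never flipped; two classes with `B ≠ B′` differ on the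
first edge by which a closed path inside one cluster leaves the other (`exit_edge`): closed in one pattern,
a boundary edge — hence open — in the other.  Verified numerically before formalisation (gen-74 code
`abthm.py`: all 773 connected instances n ≤ 6 with `ab ∈ E`, 1 838 random 7-vertex and 531 random
5-vertex multigraph instances: 0 bad cylinder points, 0 overlaps).
-/

namespace Summit.CriticalPhenomena.PercolationContinuityZ3.Theorems

namespace AntipodalR1

open Finset Relation

variable {V ι : Type*}

/-! ### Cluster bookkeeping -/

/-- Clusters are transitive. [this work] -/
theorem clus_trans {ends : ι → Sym2 V} {x : ι → Bool} {col : Bool} {u v w : V}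
    (huv : v ∈ clus ends x col u) (hvw : w ∈ clus ends x col v) : w ∈ clus ends x col u :=
  ReflTransGen.trans huv hvw

/-- Clusters are symmetric. [this work] -/
theorem clus_comm {ends : ι → Sym2 V} {x : ι → Bool} {col : Bool} {u v : V}
    (huv : v ∈ clus ends x col u) : u ∈ clus ends x col v := by
  rw [mem_clus] at huv ⊢
  induction huv with
  | refl => exact ReflTransGen.refl
  | tail _ hbc ih => exact ReflTransGen.head (nbr_symm hbc) ih

/-- An edge from a `col`-cluster to a vertex outside it has the other colour. [this work] -/
theorem color_of_exit {ends : ι → Sym2 V} {x : ι → Bool} {col : Bool} {s u w : V} {e : ι}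
    (hu : u ∈ clus ends x col s) (hw : w ∉ clus ends x col s) (he : ends e = s(u, w)) : x e = !col := by
  cases hx : x e with
  | false =>
    cases col with
    | false => exact absurd (clus_step hu ⟨e, hx, he⟩) hw
    | true => rfl
  | true =>
    cases col with
    | false => rfl
    | true => exact absurd (clus_step hu ⟨e, hx, he⟩) hw

/-- Monotonicity of clusters across colours: if every `col`-edge of `x` is a `col'`-edge of `x'`, then the
`col`-cluster of `a` in `x` lies in the `col'`-cluster of `a` in `x'`. [this work] -/
theorem clus_mono₂ {ends : ι → Sym2 V} {x x' : ι → Bool} {col col' : Bool} {a : V}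
    (h : ∀ e, x e = col → x' e = col') : clus ends x col a ⊆ clus ends x' col' a := by
  intro v hv
  rw [mem_clus] at hv ⊢
  induction hv with
  | refl => exact ReflTransGen.refl
  | tail _ huw ih =>
    obtain ⟨e, he, hends⟩ := huw
    exact ReflTransGen.tail ih ⟨e, h e he, hends⟩

/-- If `b ∉ K_a` then the closed cluster of `b` misses the closed cluster of `a`. [this work] -/
theorem not_mem_clusA_of_mem_clusB {ends : ι → Sym2 V} {x : ι → Bool} {a b v : V}
    (hKb : b ∉ clus ends x false a) (hv : v ∈ clus ends x false b) : v ∉ clus ends x false a :=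
  fun h => hKb (clus_trans h (clus_comm hv))

/-- If `b ∉ K_a` then the closed cluster of `b` lies in the region of `b` (w.r.t. `K_a`). [this work] -/
theorem mem_region_of_mem_clusB {ends : ι → Sym2 V} {x : ι → Bool} {a b v : V}
    (hKb : b ∉ clus ends x false a) (hv : v ∈ clus ends x false b) : v ∈ region ends x a b := by
  rw [mem_region]
  rw [mem_clus] at hv
  induction hv with
  | refl => exact ReflTransGen.refl
  | tail hbu huw ih =>
    obtain ⟨e, hxe, hends⟩ := huw
    exact ReflTransGen.tail ih ⟨⟨e, hends⟩, not_mem_clusA_of_mem_clusB hKb hbu,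
      not_mem_clusA_of_mem_clusB hKb (ReflTransGen.tail hbu ⟨e, hxe, hends⟩)⟩

/-- A support-graph step from the region of `b` to a vertex outside `K_a` stays in the region. [this work] -/
theorem mem_region_step {ends : ι → Sym2 V} {x : ι → Bool} {a b u w : V} {e : ι}
    (hKb : b ∉ clus ends x false a) (hu : u ∈ region ends x a b) (he : ends e = s(u, w))
    (hw : w ∉ clus ends x false a) : w ∈ region ends x a b := by
  rw [mem_region] at hu ⊢
  exact ReflTransGen.tail hu ⟨⟨e, he⟩, not_mem_clus_of_region hKb hu, hw⟩

/-- **Equal patterns force equal clusters.**  If every edge with an end in `K_b(x₁)` has an end in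
`K_b(x₂)`-sense pattern agreement — precisely: every edge incident to `K_b(x₁)` has the same colour in `x₂` —
then `K_b(x₁) ⊆ K_b(x₂)`. [this work] -/
theorem clusB_subset_of_key {ends : ι → Sym2 V} {x₁ x₂ : ι → Bool} {b : V}
    (h : ∀ e u w, ends e = s(u, w) → u ∈ clus ends x₁ false b → x₂ e = x₁ e) :
    clus ends x₁ false b ⊆ clus ends x₂ false b := by
  intro v hv
  rw [mem_clus] at hv ⊢
  induction hv with
  | refl => exact ReflTransGen.refl
  | tail hbu huw ih =>
    obtain ⟨e, hxe, hends⟩ := huw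
    exact ReflTransGen.tail ih ⟨e, by rw [h e _ _ hends hbu, hxe], hends⟩

/-- **The exit edge.**  If `K_b(x₁) ⊄ K_b(x₃)`, some edge joins a vertex of `K_b(x₁) ∩ K_b(x₃)` to a vertex
of `K_b(x₁) ∖ K_b(x₃)` and is closed in `x₁` (the first edge by which a closed path of `x₁` from `b` leaves
`K_b(x₃)`); it is then open in `x₃`. [this work] -/
theorem exit_edge {ends : ι → Sym2 V} {x₁ x₃ : ι → Bool} {b v : V}
    (hv : v ∈ clus ends x₁ false b) (hv' : v ∉ clus ends x₃ false b) :
    ∃ e u w, ends e = s(u, w) ∧ u ∈ clus ends x₁ false b ∧ u ∈ clus ends x₃ false b ∧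
      w ∈ clus ends x₁ false b ∧ w ∉ clus ends x₃ false b ∧ x₁ e = false ∧ x₃ e = true := by
  have key : ∀ v, ReflTransGen (fun u w => w ∈ nbr ends x₁ false u) b v →
      v ∈ clus ends x₃ false b ∨ ∃ e u w, ends e = s(u, w) ∧ u ∈ clus ends x₁ false b ∧
        u ∈ clus ends x₃ false b ∧ w ∈ clus ends x₁ false b ∧ w ∉ clus ends x₃ false b ∧
        x₁ e = false ∧ x₃ e = true := by
    intro v hv
    induction hv with
    | refl => exact Or.inl ReflTransGen.refl
    | @tail u w hbu huw ih =>
      rcases ih with hu3 | hex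
      · by_cases hw3 : w ∈ clus ends x₃ false b
        · exact Or.inl hw3
        · obtain ⟨e, hxe, hends⟩ := huw
          exact Or.inr ⟨e, u, w, hends, hbu, hu3, ReflTransGen.tail hbu ⟨e, hxe, hends⟩, hw3, hxe,
            by simpa using color_of_exit hu3 hw3 hends⟩
      · exact Or.inr hex
  rcases key v hv with h | h
  · exact absurd h hv'
  · exact h

variable [Fintype ι] [DecidableEq ι]

/-! ### The four forcing conditions for class-mates -/

section Forcing

variable {ends : ι → Sym2 V} {a b c : V} {x₁ x₂ : ι → Bool} {T₁ T₂ : Finset ι}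

/-- (F1) and (F2): if `T₁` avoids the edges incident to `K_b(x₁)` and `x₁ ∈ L`, the determined-open
indicator `dO` of the cylinder `Z(x₁,x₂)` has `b ∈ O_a(dO) ∖ K_a(dO)`. [this work] -/
theorem dO_mem_tSet (hab : ∃ e, ends e = s(a, b)) (hx₁ : x₁ ∈ lSet ends a b c)
    (hT₁ : ∀ e ∈ T₁, ∀ u w, ends e = s(u, w) → u ∉ clus ends x₁ false b) :
    (fun e => (decide (e ∉ T₁) && x₁ e) || (decide (e ∈ T₂) && !x₂ e)) ∈ tSet ends a b := by
  classical
  obtain ⟨_, hKb, _, _, _⟩ := (mem_filter.1 hx₁).2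
  obtain ⟨eab, heab⟩ := hab
  set dO : ι → Bool := fun e => (decide (e ∉ T₁) && x₁ e) || (decide (e ∈ T₂) && !x₂ e) with hdO
  have hbB : b ∈ clus ends x₁ false b := ReflTransGen.refl
  -- the edge `ab` is open in `x₁` (else `b ∈ K_a`) and is not flipped
  have hx₁ab : x₁ eab = true := by
    cases h : x₁ eab
    · exact absurd (ReflTransGen.single ⟨eab, h, heab⟩) hKb
    · rfl
  have heabT : eab ∉ T₁ := fun h => hT₁ eab h b a (by rw [heab, Sym2.eq_swap]) hbB
  have hdOab : dO eab = true := by simp [hdO, heabT, hx₁ab]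
  refine mem_filter.2 ⟨mem_univ _, ReflTransGen.single ⟨eab, hdOab, heab⟩, ?_⟩
  -- (F2): the complement of `K_b(x₁)` is closed under `dO`-closed steps
  have haB : a ∉ clus ends x₁ false b := fun h => hKb (clus_comm h)
  have key : ∀ v, ReflTransGen (fun u w => w ∈ nbr ends dO false u) a v → v ∉ clus ends x₁ false b := by
    intro v hv
    induction hv with
    | refl => exact haB
    | @tail u w _ huw ih =>
      intro hwB
      obtain ⟨e, hde, hends⟩ := huw
      have heT : e ∉ T₁ := fun h => hT₁ e h w u (by rw [hends, Sym2.eq_swap]) hwB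
      have hx₁e : x₁ e = false := by
        cases h : x₁ e
        · rfl
        · exfalso; have : dO e = true := by simp [hdO, heT, h]
          rw [hde] at this; exact Bool.false_ne_true this
      exact ih (clus_step hwB ⟨e, hx₁e, by rw [hends, Sym2.eq_swap]⟩)
  exact fun h => key b h hbB

/-- (F3) and (F4): if `x₁, x₂ ∈ L` have the same closed cluster `B` of `b`, `T₁` contains no closed edge of
`x₁`, and `T₂` consists of the open edges of `x₂` not incident to `B`, then the determined-closed indicator
`dK` of the cylinder `Z(x₁,x₂)` has `c ∈ O_a(dK) ∖ K_a(dK)`. [this work] -/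
theorem dK_mem_tSet (hx₁ : x₁ ∈ lSet ends a b c) (hx₂ : x₂ ∈ lSet ends a b c)
    (hB : clus ends x₁ false b = clus ends x₂ false b)
    (hT₁ : ∀ e ∈ T₁, x₁ e = true)
    (hT₂ : ∀ e, e ∈ T₂ ↔ x₂ e = true ∧ ∀ u w, ends e = s(u, w) → u ∉ clus ends x₂ false b) :
    (fun e => (decide (e ∉ T₁) && !x₁ e) || (decide (e ∈ T₂) && x₂ e)) ∈ tSet ends a c := by
  classical
  obtain ⟨_, hKb₁, _, _, hsep₁⟩ := (mem_filter.1 hx₁).2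
  obtain ⟨_, hKb₂, hOc₂, hKc₂, hsep₂⟩ := (mem_filter.1 hx₂).2
  set dK : ι → Bool := fun e => (decide (e ∉ T₁) && !x₁ e) || (decide (e ∈ T₂) && x₂ e) with hdK
  -- closed edges of `x₁` and edges of `T₂` are determined-closed
  have hK₁ : clus ends x₁ false a ⊆ clus ends dK true a := by
    refine clus_mono₂ fun e he => ?_
    have : e ∉ T₁ := fun h => by have := hT₁ e h; rw [he] at this; exact Bool.false_ne_true this
    simp [hdK, this, he]
  have hT₂K : ∀ e ∈ T₂, dK e = true := fun e he => by
    have := ((hT₂ e).1 he).1; simp [hdK, he, this]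
  refine mem_filter.2 ⟨mem_univ _, ?_, ?_⟩
  · -- (F3): every vertex of `O_a(x₂)` is in `b`'s region of `x₁` or in the `dK`-open cluster of `a`
    have key : ∀ v, ReflTransGen (fun u w => w ∈ nbr ends x₂ true u) a v →
        v ∈ region ends x₁ a b ∨ v ∈ clus ends dK true a := by
      intro v hv
      induction hv with
      | refl => exact Or.inr ReflTransGen.refl
      | @tail u w _ huw ih =>
        obtain ⟨e, hx₂e, hends⟩ := huw
        -- a vertex adjacent to the region is in the region or in `K_a(x₁)`
        have regstep : u ∈ region ends x₁ a b → w ∈ region ends x₁ a b ∨ w ∈ clus ends dK true a :=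
          fun hu => by
            by_cases hwK : w ∈ clus ends x₁ false a
            · exact Or.inr (hK₁ hwK)
            · exact Or.inl (mem_region_step hKb₁ hu hends hwK)
        rcases ih with hu | hu
        · exact regstep hu
        · by_cases heT : e ∈ T₂
          · exact Or.inr (clus_step hu ⟨e, hT₂K e heT, hends⟩)
          · -- `e` is open in `x₂` but not in `T₂`: it has an end in `B`
            have : ¬ ∀ u' w', ends e = s(u', w') → u' ∉ clus ends x₂ false b :=
              fun h => heT ((hT₂ e).2 ⟨hx₂e, h⟩)
            simp only [not_forall, not_not] at this
            obtain ⟨u', w', hends', hu'B⟩ := this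
            rw [← hB] at hu'B
            rw [hends, Sym2.eq_iff] at hends'
            rcases hends' with ⟨rfl, rfl⟩ | ⟨rfl, rfl⟩
            · exact regstep (mem_region_of_mem_clusB hKb₁ hu'B)
            · exact Or.inl (mem_region_of_mem_clusB hKb₁ hu'B)
    rcases key c hOc₂ with h | h
    · exact absurd h hsep₁
    · exact h
  · -- (F4): vertices reachable from `a` by `dK`-closed edges stay in `K_a(x₂) ∪ region_b(x₂)`
    have key : ∀ v, ReflTransGen (fun u w => w ∈ nbr ends dK false u) a v →
        v ∈ clus ends x₂ false a ∨ v ∈ region ends x₂ a b := by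
      intro v hv
      induction hv with
      | refl => exact Or.inl ReflTransGen.refl
      | @tail u w _ huw ih =>
        obtain ⟨e, hde, hends⟩ := huw
        have heT₂ : ¬ (e ∈ T₂ ∧ x₂ e = true) := by
          rintro ⟨h1, h2⟩
          have : dK e = true := by simp [hdK, h1, h2]
          rw [hde] at this; exact Bool.false_ne_true this
        rcases ih with hu | hu
        · cases hx₂e : x₂ e
          · exact Or.inl (clus_step hu ⟨e, hx₂e, hends⟩)
          · -- open in `x₂`, not in `T₂`: an end lies in `B = K_b(x₂)`; it is not `u ∈ K_a(x₂)`
            have heT : e ∉ T₂ := fun h => heT₂ ⟨h, hx₂e⟩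
            have : ¬ ∀ u' w', ends e = s(u', w') → u' ∉ clus ends x₂ false b :=
              fun h => heT ((hT₂ e).2 ⟨hx₂e, h⟩)
            simp only [not_forall, not_not] at this
            obtain ⟨u', w', hends', hu'B⟩ := this
            rw [hends, Sym2.eq_iff] at hends'
            rcases hends' with ⟨rfl, rfl⟩ | ⟨rfl, rfl⟩
            · exact absurd hu (not_mem_clusA_of_mem_clusB hKb₂ hu'B)
            · exact Or.inr (mem_region_of_mem_clusB hKb₂ hu'B)
        · by_cases hwK : w ∈ clus ends x₂ false a
          · exact Or.inl hwK
          · exact Or.inr (mem_region_step hKb₂ hu hends hwK)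
    intro h
    rcases key c h with h' | h'
    · exact hKc₂ h'
    · exact hsep₂ h'

end Forcing

/-! ### The theorem -/

/-- **ANTI₁ when the apex is adjacent to `b`.**  For every finite multigraph `ends : ι → Sym2 V` and
vertices `a, b, c` with `a ~ b`:  `#{x : b, c ∈ O_a∖K_a, K_a separates b|c} ≤ #{x : b ∈ O_a∖K_a, c ∈ K_a∖O_a}`.
Proof: the Reimer certificate with classes = patterns on the edges incident to `K_b(x)`, flip sets
`T(x) = O(x) ∖ (edges incident to K_b(x))`, all targets `R(b,c)`; (F) by `dO_mem_tSet`, `dK_mem_tSet` and the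
forcing lemma; (D) by `exit_edge`. [this work] -/
theorem card_lSet_le_card_rSet_of_adj_left (ends : ι → Sym2 V) {a b c : V}
    (hab : ∃ e, ends e = s(a, b)) : (lSet ends a b c).card ≤ (rSet ends a b c).card := by
  classical
  -- incidence to `K_b(x)`, the class key and the flip sets
  let Inc : (ι → Bool) → ι → Prop := fun x e => ∃ u w, ends e = s(u, w) ∧ u ∈ clus ends x false b
  let cls : (ι → Bool) → ι → Option Bool := fun x e => if Inc x e then some (x e) else none
  let T : (ι → Bool) → Finset ι := fun x => univ.filter fun e => x e = true ∧ ¬ Inc x e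
  have hT : ∀ x e, e ∈ T x ↔ x e = true ∧ ∀ u w, ends e = s(u, w) → u ∉ clus ends x false b := by
    intro x e; simp only [T, Inc, mem_filter, mem_univ, true_and, not_exists, not_and]
  have hTinc : ∀ x, ∀ e ∈ T x, ∀ u w, ends e = s(u, w) → u ∉ clus ends x false b :=
    fun x e he => ((hT x e).1 he).2
  have hTopen : ∀ x, ∀ e ∈ T x, x e = true := fun x e he => ((hT x e).1 he).1
  -- equal keys: equal clusters of `b`, equal colours on incident edges, incident edges unflipped
  have hkey : ∀ x₁ x₂, cls x₁ = cls x₂ → ∀ e u w, ends e = s(u, w) → u ∈ clus ends x₁ false b →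
      x₂ e = x₁ e ∧ Inc x₂ e := by
    intro x₁ x₂ h e u w hends hu
    have h1 : Inc x₁ e := ⟨u, w, hends, hu⟩
    have := congrFun h e
    simp only [cls, if_pos h1] at this
    by_cases h2 : Inc x₂ e
    · rw [if_pos h2] at this; exact ⟨(Option.some_injective _ this).symm, h2⟩
    · rw [if_neg h2] at this; exact absurd this (by simp)
  have hB : ∀ x₁ x₂, cls x₁ = cls x₂ → clus ends x₁ false b = clus ends x₂ false b := by
    intro x₁ x₂ h
    exact Set.Subset.antisymm
      (clusB_subset_of_key fun e u w he hu => (hkey x₁ x₂ h e u w he hu).1)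
      (clusB_subset_of_key fun e u w he hu => (hkey x₂ x₁ h.symm e u w he hu).1)
  -- a cylinder point agrees with `x₁` on every edge incident to `K_b(x₁)`
  have hagree : ∀ x₁ (z : ι → Bool), (∀ i, i ∉ T x₁ → z i = x₁ i) → ∀ e u w, ends e = s(u, w) →
      u ∈ clus ends x₁ false b → z e = x₁ e :=
    fun x₁ z hz e u w he hu => hz e fun heT => hTinc x₁ e heT u w he hu
  refine card_lSet_le_of_certificate ends a b c cls T (fun _ => true) ?_ ?_
  · -- (F): cylinders of class-mates lie in `R(b,c)`
    intro x₁ hx₁ x₂ hx₂ hcls z hz₁ hz₂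
    simp only [ite_true]
    exact cylinder_subset_rSet ends a b c x₁ x₂ (T x₁) (T x₂)
      (dO_mem_tSet hab hx₁ (hTinc x₁)) (dK_mem_tSet hx₁ hx₂ (hB x₁ x₂ hcls) (hTopen x₁) (hT x₂)) hz₁ hz₂
  · -- (D): cylinder points of different classes differ on an unflipped edge
    intro x₁ hx₁ x₂ _ x₃ hx₃ x₄ _ _ _ hne z z' hz₁ _ hz₃ _
    simp only [ite_true]
    intro hzz
    apply hne
    -- the two closed clusters of `b` coincide …
    have hB13 : clus ends x₁ false b = clus ends x₃ false b := by
      ext v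
      constructor
      · intro hv; by_contra hv'
        obtain ⟨e, u, w, he, hu1, hu3, _, hw3, hx1e, hx3e⟩ := exit_edge hv hv'
        have h1 := hagree x₁ z hz₁ e u w he hu1
        have h3 := hagree x₃ z' hz₃ e u w he hu3
        rw [hzz] at h1; rw [h1, hx1e] at h3; rw [hx3e] at h3; exact Bool.false_ne_true h3
      · intro hv; by_contra hv'
        obtain ⟨e, u, w, he, hu3, hu1, _, hw1, hx3e, hx1e⟩ := exit_edge hv hv'
        have h1 := hagree x₁ z hz₁ e u w he hu1
        have h3 := hagree x₃ z' hz₃ e u w he hu3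
        rw [hzz] at h1; rw [h1, hx1e] at h3; rw [hx3e] at h3; exact Bool.false_ne_true h3.symm
    -- … and then the patterns coincide
    funext e
    by_cases h1 : Inc x₁ e
    · obtain ⟨u, w, he, hu⟩ := h1
      have hu3 : u ∈ clus ends x₃ false b := hB13 ▸ hu
      have h3 : Inc x₃ e := ⟨u, w, he, hu3⟩
      have hz1 := hagree x₁ z hz₁ e u w he hu
      have hz3 := hagree x₃ z' hz₃ e u w he hu3
      rw [hzz] at hz1
      simp only [cls, if_pos (show Inc x₁ e from ⟨u, w, he, hu⟩), if_pos h3, ← hz1, ← hz3]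
    · have h3 : ¬ Inc x₃ e := fun ⟨u, w, he, hu⟩ => h1 ⟨u, w, he, hB13 ▸ hu⟩
      simp only [cls, if_neg h1, if_neg h3]

/-- **ANTI₁ when the apex is adjacent to `c`** (from the `b`-version by the `b ↔ c` symmetry of `L` and the
flip symmetry of `R`, `lSet_comm` / `card_rSet_comm` of gen 63). [this work] -/
theorem card_lSet_le_card_rSet_of_adj_right (ends : ι → Sym2 V) {a b c : V}
    (hac : ∃ e, ends e = s(a, c)) : (lSet ends a b c).card ≤ (rSet ends a b c).card := by
  rw [lSet_comm, card_rSet_comm]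
  exact card_lSet_le_card_rSet_of_adj_left ends hac

/-- **ANTI₁ when the apex is adjacent to a terminal** (either one). [this work] -/
theorem card_lSet_le_card_rSet_of_adj_apex (ends : ι → Sym2 V) {a b c : V}
    (h : (∃ e, ends e = s(a, b)) ∨ ∃ e, ends e = s(a, c)) :
    (lSet ends a b c).card ≤ (rSet ends a b c).card :=
  h.elim (card_lSet_le_card_rSet_of_adj_left ends) (card_lSet_le_card_rSet_of_adj_right ends)

end AntipodalR1

end Summit.CriticalPhenomena.PercolationContinuityZ3.Theorems
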